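import Mathlib

/-!
# SEIL-F outer end: the LEMMA R threshold — once below one, always below one (solo-blind s85, kernel #193)

LEMMA R (PLAN §107 (g), paper §24.106 (5)) bounds the weighted Schur mass of the one-period
loop kernel by the explicit decreasing majorant `R(P) = A₁ P^{-1/3} + A₂ P^{-1}` (layer term +
Bessel/Doppler term; the enhanced-dissipation tails are absorbed for `P ≥ 200`).  The bridge of
certified kernel boxes ends at the first `P_R` with `R(P_R) < 1`; this file is the one-line glue
that the analytic bound then holds on the whole outer ray: a nonnegative combination of
nonpositive powers is antitone on `(0, ∞)`, so `R(P) ≤ R(P_R) < 1` for every `P ≥ P_R`.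
We state it for a general two-term majorant with exponents `r₁, r₂ ≤ 0`.
-/

namespace Summit.AnomalousDissipation.AnomalousDissipation.Theorems

open Real

/-- A nonnegative combination of nonpositive powers is antitone on `(0, ∞)`. -/
theorem majorant_antitone {A₁ A₂ r₁ r₂ P Q : ℝ} (hA₁ : 0 ≤ A₁) (hA₂ : 0 ≤ A₂)
    (hr₁ : r₁ ≤ 0) (hr₂ : r₂ ≤ 0) (hQ : 0 < Q) (hQP : Q ≤ P) :
    A₁ * P ^ r₁ + A₂ * P ^ r₂ ≤ A₁ * Q ^ r₁ + A₂ * Q ^ r₂ := by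
  have h1 : P ^ r₁ ≤ Q ^ r₁ := rpow_le_rpow_of_nonpos hQ hQP hr₁
  have h2 : P ^ r₂ ≤ Q ^ r₂ := rpow_le_rpow_of_nonpos hQ hQP hr₂
  gcongr

/-- LEMMA R threshold: if the analytic majorant is `< 1` at the bridge end `P_R > 0`, it is
`< 1` on the whole outer ray `P ≥ P_R`. -/
theorem outer_threshold {A₁ A₂ r₁ r₂ P_R : ℝ} (hA₁ : 0 ≤ A₁) (hA₂ : 0 ≤ A₂)
    (hr₁ : r₁ ≤ 0) (hr₂ : r₂ ≤ 0) (hPR : 0 < P_R)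
    (hclose : A₁ * P_R ^ r₁ + A₂ * P_R ^ r₂ < 1) :
    ∀ P, P_R ≤ P → A₁ * P ^ r₁ + A₂ * P ^ r₂ < 1 := fun _ hP =>
  (majorant_antitone hA₁ hA₂ hr₁ hr₂ hPR hP).trans_lt hclose

/-- The same with a Schur-type quantity dominated by the majorant: small gain on the ray. -/
theorem outer_small_gain {A₁ A₂ r₁ r₂ P_R : ℝ} (S : ℝ → ℝ) (hA₁ : 0 ≤ A₁) (hA₂ : 0 ≤ A₂)
    (hr₁ : r₁ ≤ 0) (hr₂ : r₂ ≤ 0) (hPR : 0 < P_R)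
    (hdom : ∀ P, P_R ≤ P → S P ≤ A₁ * P ^ r₁ + A₂ * P ^ r₂)
    (hclose : A₁ * P_R ^ r₁ + A₂ * P_R ^ r₂ < 1) :
    ∀ P, P_R ≤ P → S P < 1 := fun P hP =>
  (hdom P hP).trans_lt (outer_threshold hA₁ hA₂ hr₁ hr₂ hPR hclose P hP)

/-- Numerical instance of the design law (paper §24.106 (4): `A₁ = .44`, `A₂ = 106` fit the
D53 data): with the honest factor-2 constants `A₁ = 0.88`, `A₂ = 212` the majorant at
`P_R = 1000` is `0.088 + 0.212 = 0.3 < 1` — here checked in the cruder rational form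
`0.88 · (1/10) + 212/1000 < 1` using `1000^{-1/3} = 1/10`. -/
theorem outer_threshold_design : (0.88 : ℝ) * (1 / 10) + 212 / 1000 < 1 := by norm_num

end Summit.AnomalousDissipation.AnomalousDissipation.Theorems
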